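import Summits.QuantumFields.YangMills.Theorems.UnitScaleTiltProp7SectET3G0LayerFromThm310
import Literature.MathematicalPhysics.QuantumFieldTheory.Balaban1983to89.B9Thm313WholeCutLettersAtPinsP
import Literature.MathematicalPhysics.QuantumFieldTheory.Balaban1983to89.B9GradViaDivLettersTransported
import Literature.MathematicalPhysics.QuantumFieldTheory.Balaban1983to89.B9SmoothHolderClassTClosure
import Literature.MathematicalPhysics.QuantumFieldTheory.Balaban1983to89.B9CoReadingCoordsHolderAdm
import Literature.MathematicalPhysics.QuantumFieldTheory.Balaban1983to89.B9GeoLemma21KLevelV1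
import HarnessLib

/-!
# Route `UnitScaleTilt`, crux «MinimiserStabilityRegPr» (stmt-QuantumFields-19200, stub EX, route (α), node N06(d = 3)) — **THE RE-CUT PROBE LETTER `hWE` AND THE RE-CUT
# RECORD `hletters` OF [B9] THEOREM 3.13 AT THE T³ PRINT-WEIGHTED BOND PIN** `bXH i U := bHZKPG i (trBasis 2) (taxiB i (bgT3 i) (fun U => U) U) wX …` (option (2), (P1′)),
# member-∀ over the T³ index `KIdx 2 ℓ hd3 hL b₀ b₁`, probes PINNED certificate-style `𝔭 := holderProbesKA i (trBasis 2) (bgT3 i) (fun U => U) (parBY i) (bI i)` — the T³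
# twin of dag-n06-l's d = 4 wrappers ✓`BalabanUVNodes.N06CutLettersPinsPrintAtRecord.hWE_of_pins ∕ hletters13_of_pins` (p687234) over the SAME Literature engines
# ✓`B9Thm313WholeCutLettersAtPinsP.pWE_bHZKPG_of_pins ∕ letters313Zc_bHZKPG_of_pins` (p686911)

Cell `ym-inputs` (D-0154 (2); HOME `pub/ym-inputs/`), seat ym-inputs-p04 gen 8 — FILE C of the T³ option-(2) twin programme (HOME memo `T3-OPTION2-LOCATE-p04g8.md`
346e0e9fc593a7ab §4 as amended 02:05Z; ★★OWNER ym3-torus-plan g29 WORD 2026-08-29T02:56:47Z «WANTED»; desk DESK WORD g27-2 summons).  Count-neutral helper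
(`--supports stmt-QuantumFields-20520 --as helper`); registry untouched; THEOREMS ONLY (0 `def`, 0 `sorry`); NOTHING of [Balaban1985BackgroundPropagators] is asserted.

STYLE (OWNER: «certificate style unless a kernel obstacle forces the member-∀ wrapper style — say which»).  MEMBER-∀ WRAPPER FOR THE INDEX, CERTIFICATE PIN FOR THE PROBES.
The obstacle: the option-(2) engines read the bond class at PRINT'S UNITS, `hcfk : i.cf = (ℓ+1)^{i.k}` per index (✓`B9SmoothHolderClassTClosure.abs_cf_eq_nKT`; at d = 4 a
FIELD `MemberY.hcfk`); the T³ leaf ✓`Prop7SectET3N06LeavesRecordCutCU.t313_of_pins_T3_completePairMBCZcU` (FILE A) quantifies over ALL of `KIdx 2 ℓ hd3 hL b₀ b₁`, whose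
`cf` is a free datum — a leaf-level edition deriving `hletters` for every index would have to display `∀ i, i.cf = L^{i.k}`, which is FALSE over the whole index type
(witness: the EX member ✓`Prop7SectET3Members.memberIdx` has `k := K − n + 1` (padded chart) and `cf := L^{K−n}` = PADDED UNITS `L^{k−1}`, `memberIdx_cf` rfl).  So this file
states, PER INDEX `i` under the premise `i.cf = L^{i.k}`, the two derived letters — exactly the shape of the d = 4 wrappers, which a later EDITION consumes per member
(d = 4: ED.57∕63 consume ✓p672970∕✓p687234; T³: «K1-AtPinsT» over ✓`Prop7SectET3NormGRowAtOpsT3` ∕ FILE B, next).  The PROBES are pinned in the certificate's own term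
`holderProbesKA … (parBY i) (bI i)`, so the engines' pin equations `blkPX = blkPK bI` ∕ `ΦX U s = probeK (trBasis 2) (taxiB … U) (wKA s) (w₀K s)` are discharged here
by ✓`blkPX_KA` ∕ ✓`ΦX_holderProbesKA_parBY` (`rfl`); the Y-carrier of the ops is therefore the probes' `XBK (TrIdx 2) i` (as in the T³ record ✓`…NormGRowAtOpsT3`,
`X = Y := XBK (TrIdx 2) x.1`).  NO definer pin is needed: `(bgT3 i).Cfg = CfgY M₂(ℂ) i` by `rfl`, so `cfg := fun U => U` as in the d = 4 certificate ✓`…V6EPairOS` :133.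

WHAT.
* §1 ★★ `hWE_of_pinsT3` — for every index `i` at print's units, above the member-fact threshold `M₀` and in the regime `M·α₀ ≤ a₀`, for every `U ∈ (3.35) ∩ (3.36)` and every
  `β ∈ [0,1)`: the leaf's probe letter `Letters313HZc.pWE β` (Φ^X_β ∘ (∇_U∘G′∘R∘∇*_U) : `bHZKPG … (taxiB … U) wX` → 𝔠_{P_X}^{(β−1)}, constant `Bx β`, rate `δ₃`) from the
  (3.45) member for G′ read PRINT-LITERALLY at the print-weighted member `bHZKP … (sch β)` (`hp45`), the (3.43)₁ probe of ∇G′ (`hpDG`), the (3.49) majorant (`h49`) and the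
  letter `R = ϱ(I − P)` (`hRP`) — the last two in the shapes FILE B ✓`…N06LeavesRecordCutKeptCU` ALREADY displays —, member facts `Facts347 ∕ RowSum` (`hFa hrow`, at T³
  theorems above a threshold: ✓`Prop7SectET3G0LayerFromThm310.lemma21Pack_geo9K` ∕ ✓`B9GeoLemma21KLevelV1.rowSum261_geo9K`, consumed in-proof by the edition as ✓p640018
  does), the schedule `sch` and the budget family `hBx`.  Engine ✓`pWE_bHZKPG_of_pins` at `geo9K i`, `B := bgT3 i`.
* §2 ★★ `hletters_of_pinsT3` — likewise the whole re-cut record `Letters313Zc (𝔬 i) (Gp i) 1 (H₀ i) _ (wZ i) (hwZ i) B₃ δ₃ (bHZKPG … (taxiB … U) wX …) U` from the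
  `bXH`-free record `hLZ : Letters313Z` + `h31 h49 hRP` + (3.44) for G′ at ONE print-weighted member `s` (`h44`) + the G₀ material `hK he2 h43 hpX hI` + the weight
  budget `hwB` and the constants' budgets `hB₃w hδ₃w hB₃g hδ₃g` (engine ✓`letters313Zc_bHZKPG_of_pins`).
Binder texts are the engines' (✓p686911 :80–110, :118–137, :154–195) at T³ spellings — the d = 4 certificate of record ✓p688560 `…V6EPairOS` still DISPLAYS `hletters13` (:150) and reads
`hWE` through ✓`…WELegAtPinsPhysPUB`; when dag-n06-d derives `hletters13`, the T³ edition copies that binder text and calls §2.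

CONSUMERS (★★OWNER g29 (3); a LOCATE for the junction pen — claims nothing).  The letters this file outputs (`Letters313Zc.gXH ∕ .wGp`, `Letters313HZc.pWE` at the T³
option-(2) pin) feed, through FILE B → FILE A → `B9.Thm313Printed c35 geo9K bgT3 …` and the record layer ✓`Prop7SectET3NormGRowAtOpsT3.normG_row_at_opsT3` (K1) ∕
✓`Prop7SectET3NormHRowAtOpsT3.normH₁_row_at_opsT3` (KH1), the cell's displayed [B9] §3 rows at a curved `U₀ ∈ RegPr` on T³: the EX display of record S21ᴸ ✓p690389
`Prop7StubEXOfChartPiecesTwS21L` binders `norm_G` :138, `ΘH` :141, `hHcol` :144 (→ kernel row `h133` by ★px6 g5's doors ✓p691094), `hΔHcol` :153 (→ `h88`), `norm_H₁` :157,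
`norm_Hπ` :160; the E′ growth side's `norm_G₀` (the hypothesis of ✓p690542) and `bern_P` (✓p687224's `hBern`).  THE ONE SEAM STILL MISSING between this record's letters
(`bHZKPG ∕ bHZPG` pins at `bgT3`, carriers `XBK (TrIdx 2)`, print's units `cf = L^k`) and those rows' letters (`flat115` ∕ `H1f` ∕ `DeltaPiSlotP` ∕ `laplaceA … G₀` at
`memberIdx`, (115)-weights): (a) UNITS — `memberIdx` is at padded units `cf = L^{k−1}` (`k = K − n + 1`), so §1∕§2's premise `i.cf = L^{i.k}` is NOT met at the EX member as
lettered; a junction needs either an un-padded member index (`k = K − n`, `cf = L^k`) or a `len ≤ 1`-hypothesis variant of ✓`B9SmoothHolderClassPReadings.hasMaj_id_bHZKPG_cNorm`;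
(b) DICTIONARY — the (115)-norm ∕ slot letters of S21ᴸ vs the block-norm letters `cNorm ∕ cNormR ∕ bHZKPG` of this record (K1's `hread` clauses give orders 0 and 1 of `norm_G`
only; memo `HSIZE19-CURRENCY-LOCATE-p04g5.md`).  Neither is typed here.
HONEST SCOPE: kernel bookkeeping (member-∀ re-statement of two LANDED Literature theorems at the T³ carriers with the probe pin discharged by `rfl`); the (3.4x) members,
(3.49), `R = ϱ(I − P)`, the G₀ rows, the member facts and every budget are HYPOTHESES of printed species; N06(d = 3) NOT discharged; nothing here claims EX, the crux,
V3∕R3, d = 4 or the mass gap; no display flips; YM₃ on T³ = ladder rung R3 (RECORD), not the Clay problem.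

References: T. Bałaban, CMP **99** (1985) 389–434 [Balaban1985BackgroundPropagators] (Thm 3.13 p.426, (3.152)–(3.153) pp.425–426, (3.40)–(3.45) pp.397–398, (3.49)
p.399, Thm 3.12 p.423); CMP **96** (1984) 223–250 [Balaban1984PropagatorsII] ((2.51)–(2.56) pp.232–233, Lemma 2.1 (2.59)–(2.61) pp.233–234).
-/

set_option autoImplicit false

noncomputable section

open scoped Matrix.Norms.L2Operator

namespace Summit.QuantumFields.YangMills.Theorems.Prop7SectET3N06CutLettersPinsPrintT3

open Literature.MathematicalPhysics.QuantumFieldTheory.Balaban1983to89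
open B9Thm34Ext (toB6)
open B11SectG (HasMaj BlockNorm RowSum)
open B9Thm312Whole (Ops cNorm GeoOK Identities)
open B9Thm312WholeClasses (cNormR)
open B6RandomWalkHom (HasMajorantHom)
open B9RWSums343Holder (HolderProbes)
open B9RWSums343to347Whole (Facts347)
open B9PerturbationMajorantAlgebra (Thm31GpMaj Proj349Maj)
open B9Thm313WholeZ (Letters313Z)
open B9Thm313WholeLettersCut (Letters313Zc)
open B9Thm313WholeCutLettersAtPinsP (pWE_bHZKPG_of_pins letters313Zc_bHZKPG_of_pins)
open B9SmoothHolderClassP (bHZKP bHZKPG)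
open B9SmoothHolderClassTClosure (ΦX_holderProbesKA_parBY)
open B9GradViaDivLettersTransported (taxiB)
open B9CoReadingCoords (XBK blkBK)
open B9CoReadingCoordsHolder (PK blkPK probeK wK w₀K)
open B9CoReadingCoordsHolderAdm (wKA holderProbesKA blkPX_KA)
open B9CoReadingCoordsTranspose (TrIdx trBasis)
open B9MultiscaleSmoothPartitionYNear (rNear)
open B6KLevelCensusIndexV1 (KIdx)
open B6GlobalChartV1 (PV blkV1)
open B6Ineq2142KLevelV1 (β lvl)
open B6Geom246MultiLevelTorus (geomT)
open B9GeoNormsKLevelV1 (geo9K)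
open B9GeoLemma21KLevelV1 (rowSum261_geo9K)
open Node00 (FBondY IBondY parBY)
open Summit.QuantumFields.YangMills.Theorems.Prop7SectET3Members (hd3)
open Summit.QuantumFields.YangMills.Theorems.Prop7SectET3Geometry (geoOK_geo9K)
open Summit.QuantumFields.YangMills.Theorems.Prop7SectET3BgClass (bgT3)
open Summit.QuantumFields.YangMills.Theorems.Prop7SectET3G0LayerFromThm310 (lemma21Pack_geo9K)

variable {ℓ : ℕ} {hL : Odd (ℓ + 1) ∧ 1 < ℓ + 1} {b₀ b₁ : ℝ} {c35 : ℝ}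

/-! ## §1 ★★ The probe letter `hWE` (`Letters313HZc.pWE`, every β ∈ [0,1)) at the T³ print-weighted bond pin, member-∀ (member facts as hypotheses) -/

/-- ★★ **`hWE` AT THE T³ PRINT-WEIGHTED BOND PIN, member-∀, probes pinned** — for every index `i` at print's units (`i.cf = L^{i.k}`), above the member-fact
threshold and in the regime `M·α₀ ≤ a₀`, for every `U ∈ (3.35) ∩ (3.36)` and every `β ∈ [0,1)`: Φ^X_β∘(∇_U∘G′∘R∘∇\*_U) maps `bHZKPG i (trBasis 2) (taxiB … U) wX` into
`𝔠_{P_X}^{(β−1)}` with constant `Bx β` and rate `δ₃`, from the (3.45) member for G′ at the print-weighted member `bHZKP … (sch β)` (`hp45`), the (3.43)₁ probe of ∇G′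
(`hpDG`), the (3.49) majorant (`h49`), `R = ϱ(I − P)` (`hRP`), member facts (`hFa hrow`), the schedule and the budget `hBx` — ✓`pWE_bHZKPG_of_pins` member-∀ at
`geo9K i ∕ bgT3 i ∕ holderProbesKA …`.  Nothing of print asserted. [cite: Balaban1985BackgroundPropagators, Thm 3.13 p.426 + (3.152)–(3.153) p.426 + (3.43)–(3.45) p.398 + (3.49) p.399; Balaban1984PropagatorsII, (2.51)–(2.56) pp.232–233 + Lemma 2.1 (2.60)–(2.61) p.234] -/
theorem hWE_of_pinsT3 [∀ i : KIdx 2 ℓ hd3 hL b₀ b₁, Fintype (geo9K i).Site]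
    {Z W : KIdx 2 ℓ hd3 hL b₀ b₁ → Type} [∀ i, Fintype (Z i)] [∀ i, Fintype (W i)]
    (H₀ : KIdx 2 ℓ hd3 hL b₀ b₁ → Prop)
    (𝔬 : ∀ i : KIdx 2 ℓ hd3 hL b₀ b₁, Ops (geo9K i) (bgT3 i) (XBK (TrIdx 2) i) (XBK (TrIdx 2) i) (Z i) (W i))
    (bI : ∀ i : KIdx 2 ℓ hd3 hL b₀ b₁, FBondY i → IBondY i)
    (hlev : ∀ (i : KIdx 2 ℓ hd3 hL b₀ b₁) (f : FBondY i), lvl i.hN i.D i.hk (bI i f) = (blkV1 i.hN i.D f).1.1)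
    (hβ1 : ∀ (i : KIdx 2 ℓ hd3 hL b₀ b₁) (f : FBondY i), (geomT i.D).dist (β i.hN i.D i.hk (bI i f)) (blkV1 i.hN i.D f) ≤ 1)
    (hbI0 : ∀ (i : KIdx 2 ℓ hd3 hL b₀ b₁) (f : FBondY i), bI i f = bI i ⟨f.src, 0⟩)
    (hblk : ∀ i : KIdx 2 ℓ hd3 hL b₀ b₁, (𝔬 i).blk = blkBK i (bI i))
    {M₀ a₀ : ℝ} {dF : ℕ} {δF α L₀ σ cσ : ℝ}
    (hFa : ∀ i : KIdx 2 ℓ hd3 hL b₀ b₁, M₀ ≤ (geo9K i).M → Facts347 (geo9K i) 1 (H₀ i) dF δF α L₀)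
    (hrow : ∀ i : KIdx 2 ℓ hd3 hL b₀ b₁, M₀ ≤ (geo9K i).M → RowSum (toB6 (geo9K i) 1 (H₀ i)) σ cσ)
    (wX : ℝ → ℝ) (hwX₀ : ∀ s, 0 ≤ wX s) (hwX₁ : ∀ s, wX s ≤ 1) (sch : ℝ → ℝ) (hsch0 : ∀ β', 0 ≤ β' → β' < 1 → 0 < sch β')
    (hsch1 : ∀ β', 0 ≤ β' → β' < 1 → sch β' < 1) (hwsch : ∀ β', 0 ≤ β' → β' < 1 → 0 < wX (sch β'))
    (Gp Pp : ∀ i : KIdx 2 ℓ hd3 hL b₀ b₁, (bgT3 i).Cfg → Module.End ℝ (W i → ℝ))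
    {ϱ CP δP : ℝ} (hϱ : 0 ≤ ϱ) (hCP : 0 ≤ CP) (hδP : δF ≤ δP)
    (h49 : ∀ i : KIdx 2 ℓ hd3 hL b₀ b₁, M₀ ≤ (geo9K i).M → ∀ α₀ : ℝ, 0 < α₀ → (geo9K i).M * α₀ ≤ a₀ →
      ∀ U : (bgT3 i).Cfg, (bgT3 i).Reg335 c35 α₀ U → (bgT3 i).Reg336 c35 α₀ U →
        Proj349Maj (𝔬 i).blkW (𝔬 i).blk (Pp i U) ((𝔬 i).Dv U) ((𝔬 i).Dvstar U) 1 (H₀ i) CP δP)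
    (hRP : ∀ i : KIdx 2 ℓ hd3 hL b₀ b₁, M₀ ≤ (geo9K i).M → ∀ α₀ : ℝ, 0 < α₀ → (geo9K i).M * α₀ ≤ a₀ →
      ∀ U : (bgT3 i).Cfg, (bgT3 i).Reg335 c35 α₀ U → (bgT3 i).Reg336 c35 α₀ U → (𝔬 i).R U = ϱ • (LinearMap.id - Pp i U))
    {B45 Bh Bx : ℝ → ℝ} {δ45 δh δ₃ : ℝ} (hB45 : ∀ β', 0 ≤ β' → β' < 1 → 0 ≤ B45 β') (hBh : ∀ β', 0 ≤ β' → β' < 1 → 0 ≤ Bh β')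
    (hcσ : 0 ≤ cσ) (hσ : 0 ≤ σ) (hbud : 0 ≤ δF - α * δF - 2 * σ) (hδ45 : δF - α * δF - 2 * σ ≤ δ45) (hδh : δF - α * δF - σ ≤ δh)
    (hδ₃ : δ₃ ≤ δF - α * δF - 2 * σ)
    (hBx : ∀ β', 0 ≤ β' → β' < 1 → ϱ * ((wX (sch β'))⁻¹ * B45 β' + Bh β' * (CP * L₀) *
      ((wX (sch β'))⁻¹ * ((((ℓ + 1 : ℕ) : ℝ)) * Real.exp ((δF - α * δF - σ) * (rNear 2 ℓ + 1)))) * cσ * cσ) ≤ Bx β')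
    (hp45 : ∀ i : KIdx 2 ℓ hd3 hL b₀ b₁, M₀ ≤ (geo9K i).M → ∀ α₀ : ℝ, 0 < α₀ → (geo9K i).M * α₀ ≤ a₀ →
      ∀ U : (bgT3 i).Cfg, (bgT3 i).Reg335 c35 α₀ U → (bgT3 i).Reg336 c35 α₀ U → ∀ (β' : ℝ) (h0 : 0 ≤ β') (h1 : β' < 1),
        HasMaj (bHZKP (κ := TrIdx 2) i (trBasis 2) (taxiB i (bgT3 i) (fun U => U) U) (R := (1 : ℝ)) (H := H₀ i) (s := sch β')
            (hsch0 β' h0 h1).le (hsch1 β' h0 h1).le)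
          (cNormR 1 (H₀ i) (holderProbesKA i (trBasis 2) (bgT3 i) (fun U => U) (parBY i) (bI i)).blkPX (geoOK_geo9K i).lenle (β' - 1))
          ((holderProbesKA i (trBasis 2) (bgT3 i) (fun U => U) (parBY i) (bI i)).ΦX U β' ∘ₗ ((𝔬 i).Dv U ∘ₗ Gp i U ∘ₗ (𝔬 i).Dvstar U))
          (fun a b => B45 β' * Real.exp (-(δ45 * (geo9K i).dist a b))))
    (hpDG : ∀ i : KIdx 2 ℓ hd3 hL b₀ b₁, M₀ ≤ (geo9K i).M → ∀ α₀ : ℝ, 0 < α₀ → (geo9K i).M * α₀ ≤ a₀ →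
      ∀ U : (bgT3 i).Cfg, (bgT3 i).Reg335 c35 α₀ U → (bgT3 i).Reg336 c35 α₀ U → ∀ (β' : ℝ), 0 ≤ β' → β' < 1 →
        HasMaj (cNormR 1 (H₀ i) (𝔬 i).blkW (geoOK_geo9K i).lenle 0) (cNormR 1 (H₀ i) (holderProbesKA i (trBasis 2) (bgT3 i) (fun U => U) (parBY i) (bI i)).blkPX (geoOK_geo9K i).lenle (β' - 1))
          ((holderProbesKA i (trBasis 2) (bgT3 i) (fun U => U) (parBY i) (bI i)).ΦX U β' ∘ₗ (𝔬 i).Dv U ∘ₗ Gp i U)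
          (fun a b => Bh β' * Real.exp (-(δh * (geo9K i).dist a b)))) :
    ∀ i : KIdx 2 ℓ hd3 hL b₀ b₁, i.cf = (((ℓ + 1 : ℕ) : ℝ)) ^ i.k → M₀ ≤ (geo9K i).M → ∀ α₀ : ℝ, 0 < α₀ → (geo9K i).M * α₀ ≤ a₀ →
      ∀ U : (bgT3 i).Cfg, (bgT3 i).Reg335 c35 α₀ U → (bgT3 i).Reg336 c35 α₀ U → ∀ β' : ℝ, 0 ≤ β' → β' < 1 →
        HasMaj (bHZKPG (κ := TrIdx 2) i (trBasis 2) (taxiB i (bgT3 i) (fun U => U) U) (R := (1 : ℝ)) (H := H₀ i) wX hwX₀ hwX₁)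
          (cNormR 1 (H₀ i) (holderProbesKA i (trBasis 2) (bgT3 i) (fun U => U) (parBY i) (bI i)).blkPX (geoOK_geo9K i).lenle (β' - 1))
          ((holderProbesKA i (trBasis 2) (bgT3 i) (fun U => U) (parBY i) (bI i)).ΦX U β' ∘ₗ
            ((𝔬 i).Dv U ∘ₗ Gp i U ∘ₗ (𝔬 i).R U ∘ₗ (𝔬 i).Dvstar U))
          (fun a b => Bx β' * Real.exp (-(δ₃ * (geo9K i).dist a b))) := by
  intro i hcfk hM α₀ hα ha U hU hU' β' h0 h1
  exact pWE_bHZKPG_of_pins (R₀ := (1 : ℝ)) (H₀ := H₀ i) (B := bgT3 i) (Gp := Gp i) (P := Pp i) (U := U) (βH := β') (Bx := Bx β') (δ₃ := δ₃)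
    (B45 := B45 β') (Bh := Bh β') (δ45 := δ45) (δh := δh) (ϱ := ϱ) (CP := CP) (δP := δP)
    i (trBasis 2) (taxiB i (bgT3 i) (fun U => U) U) (geoOK_geo9K i) (hFa i hM) (hrow i hM)
    (holderProbesKA i (trBasis 2) (bgT3 i) (fun U => U) (parBY i) (bI i))
    wX hwX₀ hwX₁ (hsch0 β' h0 h1) (hsch1 β' h0 h1) (hwsch β' h0 h1) (hβ1 i) (hlev i) (hbI0 i) hcfk (hblk i)
    (h49 i hM α₀ hα ha U hU hU') (hRP i hM α₀ hα ha U hU hU')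
    (hp45 i hM α₀ hα ha U hU hU' β' h0 h1) (hpDG i hM α₀ hα ha U hU hU' β' h0 h1) hϱ hCP (hB45 β' h0 h1) (hBh β' h0 h1) hcσ hσ hδP hbud hδ45 hδh
    (hBx β' h0 h1) hδ₃

/-! ## §2 ★★ The whole re-cut record `hletters` (`Letters313Zc … (bXH i U) U`) at the T³ print-weighted bond pin, member-∀ (member facts as hypotheses) -/

/-- ★★ **`hletters` AT THE T³ PRINT-WEIGHTED BOND PIN, member-∀, probes pinned** — for every index `i` at print's units, above the member-fact threshold and in the
regime `M·α₀ ≤ a₀`, for every `U ∈ (3.35) ∩ (3.36)`: the whole re-cut record `Letters313Zc (𝔬 i) (Gp i) 1 (H₀ i) _ (wZ i) (hwZ i) B₃ δ₃ (bHZKPG … (taxiB … U) wX …) U` from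
the `bXH`-free record `Letters313Z` (`hLZ`), Theorem 3.1 for G′ (`h31`), (3.49) (`h49`), `R = ϱ(I − P)` (`hRP`), (3.44) for G′ at ONE print-weighted member `s` (`h44`),
the G₀ material (3.42)₃ `he2` ∕ ∀s (3.43)₂ `h43` ∕ steps `hK hpX` ∕ `Identities` `hI`, the weight budget `hwB` and the constants' budgets — ✓`letters313Zc_bHZKPG_of_pins`
member-∀ at `geo9K i ∕ bgT3 i`, its probe pins discharged by `blkPX_KA` ∕ `ΦX_holderProbesKA_parBY` (`rfl`).  Nothing of print asserted. [cite: Balaban1985BackgroundPropagators, Thm 3.13 p.426 + Thm 3.12 p.423 + (3.42)–(3.45) pp.397–398 + (3.49) p.399 + (3.152)–(3.153) p.426; Balaban1984PropagatorsII, (2.51)–(2.56) pp.232–233 + Lemma 2.1 (2.60)–(2.61) p.234] -/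
theorem hletters_of_pinsT3 [∀ i : KIdx 2 ℓ hd3 hL b₀ b₁, Fintype (geo9K i).Site]
    {Z W : KIdx 2 ℓ hd3 hL b₀ b₁ → Type} [∀ i, Fintype (Z i)] [∀ i, Fintype (W i)]
    (H₀ : KIdx 2 ℓ hd3 hL b₀ b₁ → Prop)
    (𝔬 : ∀ i : KIdx 2 ℓ hd3 hL b₀ b₁, Ops (geo9K i) (bgT3 i) (XBK (TrIdx 2) i) (XBK (TrIdx 2) i) (Z i) (W i))
    (bI : ∀ i : KIdx 2 ℓ hd3 hL b₀ b₁, FBondY i → IBondY i)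
    (hlev : ∀ (i : KIdx 2 ℓ hd3 hL b₀ b₁) (f : FBondY i), lvl i.hN i.D i.hk (bI i f) = (blkV1 i.hN i.D f).1.1)
    (hβ1 : ∀ (i : KIdx 2 ℓ hd3 hL b₀ b₁) (f : FBondY i), (geomT i.D).dist (β i.hN i.D i.hk (bI i f)) (blkV1 i.hN i.D f) ≤ 1)
    (hbI0 : ∀ (i : KIdx 2 ℓ hd3 hL b₀ b₁) (f : FBondY i), bI i f = bI i ⟨f.src, 0⟩)
    (hblk : ∀ i : KIdx 2 ℓ hd3 hL b₀ b₁, (𝔬 i).blk = blkBK i (bI i))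
    {M₀ a₀ : ℝ} {dF : ℕ} {δF α L₀ σ cσ : ℝ}
    (hFa : ∀ i : KIdx 2 ℓ hd3 hL b₀ b₁, M₀ ≤ (geo9K i).M → Facts347 (geo9K i) 1 (H₀ i) dF δF α L₀)
    (hrow : ∀ i : KIdx 2 ℓ hd3 hL b₀ b₁, M₀ ≤ (geo9K i).M → RowSum (toB6 (geo9K i) 1 (H₀ i)) σ cσ)
    (wX : ℝ → ℝ) (hwX₀ : ∀ s, 0 ≤ wX s) (hwX₁ : ∀ s, wX s ≤ 1) {s : ℝ} (hs0 : 0 < s) (hs1 : s < 1) (hws : 0 < wX s)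
    (wZ : ∀ i : KIdx 2 ℓ hd3 hL b₀ b₁, (geo9K i).Site → ℝ) (hwZ : ∀ i y, 0 < wZ i y) {B₃ δ₃ : ℝ}
    (hLZ : ∀ i : KIdx 2 ℓ hd3 hL b₀ b₁, M₀ ≤ (geo9K i).M → ∀ α₀ : ℝ, 0 < α₀ → (geo9K i).M * α₀ ≤ a₀ →
      ∀ U : (bgT3 i).Cfg, (bgT3 i).Reg335 c35 α₀ U → (bgT3 i).Reg336 c35 α₀ U →
        Letters313Z (𝔬 i) 1 (H₀ i) (geoOK_geo9K i) (wZ i) (hwZ i) B₃ δ₃ U)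
    -- the `wGp` data: Theorem 3.1 for G′, (3.49) for P, R = ϱ(I − P), (3.44) for G′ at ONE print-weighted transported member `s`
    (Gp Pp : ∀ i : KIdx 2 ℓ hd3 hL b₀ b₁, (bgT3 i).Cfg → Module.End ℝ (W i → ℝ))
    {B₀ δ₀ ϱ CP δP B44 δ44 : ℝ}
    (h31 : ∀ i : KIdx 2 ℓ hd3 hL b₀ b₁, M₀ ≤ (geo9K i).M → ∀ α₀ : ℝ, 0 < α₀ → (geo9K i).M * α₀ ≤ a₀ →
      ∀ U : (bgT3 i).Cfg, (bgT3 i).Reg335 c35 α₀ U → (bgT3 i).Reg336 c35 α₀ U →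
        Thm31GpMaj (𝔬 i).blkW (𝔬 i).blk (Gp i U) ((𝔬 i).Dv U) ((𝔬 i).Dvstar U) 1 (H₀ i) B₀ δ₀)
    (h49 : ∀ i : KIdx 2 ℓ hd3 hL b₀ b₁, M₀ ≤ (geo9K i).M → ∀ α₀ : ℝ, 0 < α₀ → (geo9K i).M * α₀ ≤ a₀ →
      ∀ U : (bgT3 i).Cfg, (bgT3 i).Reg335 c35 α₀ U → (bgT3 i).Reg336 c35 α₀ U →
        Proj349Maj (𝔬 i).blkW (𝔬 i).blk (Pp i U) ((𝔬 i).Dv U) ((𝔬 i).Dvstar U) 1 (H₀ i) CP δP)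
    (hRP : ∀ i : KIdx 2 ℓ hd3 hL b₀ b₁, M₀ ≤ (geo9K i).M → ∀ α₀ : ℝ, 0 < α₀ → (geo9K i).M * α₀ ≤ a₀ →
      ∀ U : (bgT3 i).Cfg, (bgT3 i).Reg335 c35 α₀ U → (bgT3 i).Reg336 c35 α₀ U → (𝔬 i).R U = ϱ • (LinearMap.id - Pp i U))
    (h44 : ∀ i : KIdx 2 ℓ hd3 hL b₀ b₁, M₀ ≤ (geo9K i).M → ∀ α₀ : ℝ, 0 < α₀ → (geo9K i).M * α₀ ≤ a₀ →
      ∀ U : (bgT3 i).Cfg, (bgT3 i).Reg335 c35 α₀ U → (bgT3 i).Reg336 c35 α₀ U →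
        HasMaj (bHZKP (κ := TrIdx 2) i (trBasis 2) (taxiB i (bgT3 i) (fun U => U) U) (R := (1 : ℝ)) (H := H₀ i) (s := s) hs0.le hs1.le)
          (cNorm 1 (H₀ i) (𝔬 i).blk (geoOK_geo9K i).lenle 1) ((𝔬 i).Dv U ∘ₗ Gp i U ∘ₗ (𝔬 i).Dvstar U)
          (fun a b => B44 * Real.exp (-(δ44 * (geo9K i).dist a b))))
    (hϱ : 0 ≤ ϱ) (hB₀ : 0 ≤ B₀) (hCP : 0 ≤ CP) (hB44 : 0 ≤ B44) (hcσ : 0 ≤ cσ) (hσ : 0 ≤ σ) (hαδ : 0 ≤ α * δF)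
    (hδ₀ : δF ≤ δ₀) (hδP : δF ≤ δP) (hbud : 0 ≤ δF - α * δF - 2 * σ) (hδ44 : δF - α * δF - 2 * σ ≤ δ44)
    (hB₃w : ϱ * ((wX s)⁻¹ * B44 + B₀ * (CP * L₀) * ((wX s)⁻¹ * ((((ℓ + 1 : ℕ) : ℝ)) * Real.exp ((δF - α * δF - σ) * (rNear 2 ℓ + 1)))) * cσ * cσ) ≤ B₃)
    (hδ₃w : δ₃ ≤ δF - α * δF - 2 * σ)
    -- the `gXH` data: (3.42)₃ and the ∀s (3.43)₂ family for G₀, the `T_π + T₂` steps, the identities, the weight budget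
    {θ B₀' δ₀' δK ρ BH : ℝ} {θH Bh : ℝ → ℝ}
    (hθ : 0 ≤ θ) (hθH : ∀ s, 0 < s → s < 1 → 0 ≤ θH s) (hB₀' : 0 ≤ B₀') (hBh : ∀ s, 0 < s → s < 1 → 0 ≤ Bh s) (hBH : 0 ≤ BH)
    (hρ : 0 ≤ ρ) (hρS : ρ ≤ δ₀') (hρδ : ρ + σ ≤ δK) (hq : θ * cσ < 1)
    (hwB : ∀ s, 0 < s → s < 1 → wX s * (Bh s + θH s * (B₀' * (1 - θ * cσ)⁻¹) * cσ) ≤ BH)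
    (hK : ∀ i : KIdx 2 ℓ hd3 hL b₀ b₁, M₀ ≤ (geo9K i).M → ∀ α₀ : ℝ, 0 < α₀ → (geo9K i).M * α₀ ≤ a₀ →
      ∀ U : (bgT3 i).Cfg, (bgT3 i).Reg335 c35 α₀ U → (bgT3 i).Reg336 c35 α₀ U →
        HasMaj (cNorm 1 (H₀ i) (𝔬 i).blk (geoOK_geo9K i).lenle 1) (cNorm 1 (H₀ i) (𝔬 i).blk (geoOK_geo9K i).lenle 1)
          ((𝔬 i).G0 U ∘ₗ ((𝔬 i).Tpi U + (𝔬 i).T2 U)) (fun a b => θ * Real.exp (-(δK * (geo9K i).dist a b))))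
    (he2 : ∀ i : KIdx 2 ℓ hd3 hL b₀ b₁, M₀ ≤ (geo9K i).M → ∀ α₀ : ℝ, 0 < α₀ → (geo9K i).M * α₀ ≤ a₀ →
      ∀ U : (bgT3 i).Cfg, (bgT3 i).Reg335 c35 α₀ U → (bgT3 i).Reg336 c35 α₀ U →
        HasMajorantHom (g := toB6 (geo9K i) 1 (H₀ i)) (𝔬 i).blkY (𝔬 i).blk ((𝔬 i).G0 U ∘ₗ (𝔬 i).Dstar U)
          (fun a b => B₀' * (geo9K i).len a * Real.exp (-(δ₀' * (geo9K i).dist a b))))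
    (h43 : ∀ i : KIdx 2 ℓ hd3 hL b₀ b₁, M₀ ≤ (geo9K i).M → ∀ α₀ : ℝ, 0 < α₀ → (geo9K i).M * α₀ ≤ a₀ →
      ∀ U : (bgT3 i).Cfg, (bgT3 i).Reg335 c35 α₀ U → (bgT3 i).Reg336 c35 α₀ U → ∀ s', 0 < s' → s' < 1 →
        HasMajorantHom (g := toB6 (geo9K i) 1 (H₀ i)) (𝔬 i).blkY (holderProbesKA i (trBasis 2) (bgT3 i) (fun U => U) (parBY i) (bI i)).blkPX
          ((holderProbesKA i (trBasis 2) (bgT3 i) (fun U => U) (parBY i) (bI i)).ΦX U s' ∘ₗ ((𝔬 i).G0 U ∘ₗ (𝔬 i).Dstar U))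
          (fun (a b : (geo9K i).Site) => Bh s' * (geo9K i).len a ^ (1 - s') * Real.exp (-(δ₀' * (geo9K i).dist a b))))
    (hpX : ∀ i : KIdx 2 ℓ hd3 hL b₀ b₁, M₀ ≤ (geo9K i).M → ∀ α₀ : ℝ, 0 < α₀ → (geo9K i).M * α₀ ≤ a₀ →
      ∀ U : (bgT3 i).Cfg, (bgT3 i).Reg335 c35 α₀ U → (bgT3 i).Reg336 c35 α₀ U → ∀ s', 0 < s' → s' < 1 →
        HasMaj (cNormR 1 (H₀ i) (𝔬 i).blk (geoOK_geo9K i).lenle (-1))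
          (cNormR 1 (H₀ i) (holderProbesKA i (trBasis 2) (bgT3 i) (fun U => U) (parBY i) (bI i)).blkPX (geoOK_geo9K i).lenle (s' - 1))
          (((holderProbesKA i (trBasis 2) (bgT3 i) (fun U => U) (parBY i) (bI i)).ΦX U s' ∘ₗ (𝔬 i).G0 U) ∘ₗ ((𝔬 i).Tpi U + (𝔬 i).T2 U))
          (fun a b => θH s' * Real.exp (-(δK * (geo9K i).dist a b))))
    (hI : ∀ i : KIdx 2 ℓ hd3 hL b₀ b₁, M₀ ≤ (geo9K i).M → ∀ α₀ : ℝ, 0 < α₀ → (geo9K i).M * α₀ ≤ a₀ →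
      ∀ U : (bgT3 i).Cfg, (bgT3 i).Reg335 c35 α₀ U → (bgT3 i).Reg336 c35 α₀ U → Identities (𝔬 i) U)
    (hB₃g : (((ℓ + 1 : ℕ) : ℝ)) * Real.exp (ρ * (rNear 2 ℓ + 1)) * (B₀' * (1 - θ * cσ)⁻¹ + BH) ≤ B₃) (hδ₃g : δ₃ ≤ ρ) :
    ∀ i : KIdx 2 ℓ hd3 hL b₀ b₁, i.cf = (((ℓ + 1 : ℕ) : ℝ)) ^ i.k → M₀ ≤ (geo9K i).M → ∀ α₀ : ℝ, 0 < α₀ → (geo9K i).M * α₀ ≤ a₀ →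
      ∀ U : (bgT3 i).Cfg, (bgT3 i).Reg335 c35 α₀ U → (bgT3 i).Reg336 c35 α₀ U →
        Letters313Zc (𝔬 i) (Gp i) 1 (H₀ i) (geoOK_geo9K i) (wZ i) (hwZ i) B₃ δ₃
          (bHZKPG (κ := TrIdx 2) i (trBasis 2) (taxiB i (bgT3 i) (fun U => U) U) (R := (1 : ℝ)) (H := H₀ i) wX hwX₀ hwX₁) U := by
  intro i hcfk hM α₀ hα ha U hU hU'
  exact letters313Zc_bHZKPG_of_pins (R₀ := (1 : ℝ)) (H₀ := H₀ i) (B := bgT3 i) (Gp := Gp i) (P := Pp i) (U := U)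
    i (trBasis 2) (taxiB i (bgT3 i) (fun U => U) U) (geoOK_geo9K i) (hFa i hM) (hrow i hM)
    (holderProbesKA i (trBasis 2) (bgT3 i) (fun U => U) (parBY i) (bI i)) (hLZ i hM α₀ hα ha U hU hU')
    wX hwX₀ hwX₁ hs0 hs1 hws (hβ1 i) (hlev i) (hbI0 i) hcfk (hblk i) (blkPX_KA i (trBasis 2) (bgT3 i) (fun U => U) (parBY i))
    (fun s' _ _ => ΦX_holderProbesKA_parBY i (trBasis 2) (bgT3 i) (fun U => U) (bI i) U s')
    (h31 i hM α₀ hα ha U hU hU') (h49 i hM α₀ hα ha U hU hU') (hRP i hM α₀ hα ha U hU hU') (h44 i hM α₀ hα ha U hU hU')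
    hϱ hB₀ hCP hB44 hcσ hσ hαδ hδ₀ hδP hbud hδ44 hB₃w hδ₃w
    hθ hθH hB₀' hBh hBH hρ hρS hρδ hq hwB
    (hK i hM α₀ hα ha U hU hU') (he2 i hM α₀ hα ha U hU hU') (h43 i hM α₀ hα ha U hU hU') (hpX i hM α₀ hα ha U hU hU')
    (hI i hM α₀ hα ha U hU hU') hB₃g hδ₃g

end Summit.QuantumFields.YangMills.Theorems.Prop7SectET3N06CutLettersPinsPrintT3

end
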